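/-
Copyright (c) 2026 the pub-hodgecm-mathlib formalisation cell (harness21).  Prover seat hodgecm-mathlib-LH5-p05 (g6); dealer LH4-plan (g7) WORD #35 (the (C5)′ row
«Vanishing» of census bd72510a, (C5)′ LEAD LH3-p02 (g6)), 2026-09-02.  Bodies = ★ `UnitOrbitalIntegralInertCountJPosVanishing` (A-p03 (g24)) re-keyed 2-free.
-/
import Literature.NumberTheory.Automorphic.UnitaryThreeBorelConjugateCongruencesTrace   -- ★ p851957 (C3a): `borel_conj_mem_unitaryInt_iff_of_rel` (the four conditions for a GENERAL corner), `v_norm_eq_one_of_trace_unit`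
import Literature.NumberTheory.Automorphic.UnitaryThreeBorelNormalFormUnramified        -- ★ p851950 (i): `exists_coe_eq_borel_of_mem_flickerPH'` (datum-free shape of `P_H`)
import Literature.NumberTheory.Automorphic.UnitaryThreeBorelCosetCount                   -- ★ (F4) LAYER B: `natCard_cosets_eq_zero_of_forall_not` (CITE, datum-free)
import HarnessLib

/-!
# Flicker's Prop. 10, the vanishing beyond `j = N`, WITHOUT `|2| = 1`: no coset of `P_H ∩ H^K_m` conjugates `(r_i)⁻¹ t r_i` into `H^K_m` when `2i + θ̄ > N`
# — for the 2-free level elements `u_m^{(y,z)}` and the trace-frame torus literal, every residue characteristic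

Topic `NumberTheory/Rogawski1990` (half A line LH4, LAYER C of the (D-UNR) type-(1) column, (C5)′ row «Vanishing» of CENSUS-C5 bd72510a (LH3-p02 (g6)); dealer
LH4-plan (g7) WORD #35); namespace `Literature.NumberTheory.Automorphic.UnitaryGroup` (= ★'s).  THEOREMS ONLY: no definition, no named fact, no instance, no notation,
no `sorry`; kernel lane `--supports stmt-HodgeConjecture-24833`; NOT an edition of ★ `UnitOrbitalIntegralInertCountJPosVanishing` (untouched).

THE MATHEMATICS (Flicker p. 85 «`ν = N − j`»; p. 86 «to have solutions we must have `ν ≥ 0`»).  For a block element `τ = !![A, 0, B₁; 0, b, 0; B₂, 0, D] ∈ H`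
(GENERAL corner — the trace torus conjugate is NOT equal-diagonal: `A − D = (x₁ − x₃)(σb₀ − b₀)`) and `p = p(u, x, w) ∈ P_H` (★ p851950), the FIRST of the four
conditions of ★ p851957 `borel_conj_mem_unitaryInt_iff_of_rel` for «`u_m⁻¹ (p⁻¹ τ p) u_m ∈ K₀`» reads `|uσu·B₂| ≤ 1`; since `|u| = |σu| = 1`, it FAILS whenever `|B₂| > 1`,
for EVERY `p` — so the coset count `#{w ∈ P_H ⧸ (P_H ∩ H^K_m) : w̃⁻¹ τ w̃ ∈ H^K_m}` is `0` (**`natCard_cosets_eq_zero_of_one_lt_of_rel`**).  No residual equation is ever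
formed: the obstruction is the bare valuation `|B₂| > 1`, identical at every residue characteristic and for every row type (FINDING #19 ∕ #18 do not touch this cell —
`E = (x₁−x₂)σb₀ + (x₃−x₂)b₀` never enters; only `|x₁ − x₃| = |ϖ^N|` does).  At the trace torus literal of ★ F1 `UnitaryThreeTorusBlockElementsTrace`,
`t = M(x₁, x₂, x₃) = !![x₁σb₀ + x₃b₀, 0, π(x₁ − x₃); 0, x₂, 0; π′·b₀σb₀·(x₁ − x₃), 0, x₁b₀ + x₃σb₀]` (`b₀ + σb₀ = 1`, `π′ = ϖ^{−θ̄}`) and `r_i = diag(ϖ^{−i}, 1, ϖ^i)`,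
the conjugate `r_i⁻¹ t r_i` has lower corner `B₂ = π′ b₀σb₀ (x₁ − x₃)·ϖ^{−2i}` of valuation `|ϖ|^{N − 2i − θ̄}` (`|b₀σb₀| = 1` by ★ `v_norm_eq_one_of_trace_unit`, `|b₀| ≤ 1` alone),
hence `> 1` iff `N < 2i + θ̄` (**`natCard_cosets_traceTorus_eq_zero_of_lt`**) — the summands of Cor. 9 beyond `j = N` vanish, bounding the support of the trace-frame
Cor. 9 sum ★ p851921 to `i ≤ N∕2` exactly as ★ does for Flicker's frame.  The conjugation `r_i⁻¹ τ r_i` for a general corner is §1 (`coe_radial_inv_mul_block_mul_radial`,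
the corner-general twin of ★ `coe_radial_inv_mul_flickerTorus_mul_radial`; (C5)′ `…CountJPosTrace` may CITE it).

RE-KEY (surgery T2 of CENSUS-LAYERB-3of3; block ★ p851872 :107): `(hd : LocalConjDatum σ ϖ) {y} (hy : y·σy = −2) (hum : um = Flicker's u_m)` ↦
`(hd : UnramifiedLocalConjDatum σ ϖ) (h2 : (2 : K) ≠ 0) {y z : K} (hy : Valued.v y = 1) (hz : z + σ z + y * σ y = 0) (hu : u = u_m^{(y,z)})` (`h2` is the CHARACTERISTIC
token behind the block shape of `P_H`, read by ★ p851950; `hzv : |z| ≤ 1` is NOT read here and therefore not bound); `{e θ θ'} (h2e : 2e = 1) (hθ') (hte)` ↦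
`{b₀ π π'} (hb₀ : b₀ + σ b₀ = 1) (hb₀v : Valued.v b₀ ≤ 1) (hπ' : π' = (ϖ ^ θbar)⁻¹) (ht : ↑t = M(x₁,x₂,x₃))`; the unused centrality binders `hτH`∕`htH`∕`hrH` of ★ are DROPPED
(★ needed them only to state the `↔` of ★ `borel_conj_mem_flickerHK_iff`; the vanishing reads the `→` through ★ `mem_flickerHK_iff`).  CONCLUSIONS = ★'s VERBATIM
(`Nat.card {w ∕∕ (out w)⁻¹ * τ * out w ∈ flickerHK σ J c u} = 0`, `um ↦ u`).

HONEST LABEL: HC_CM is proved only modulo the 7 printed citations (2 remaining: hLiu418 = stmt-HodgeConjecture-24832, h413 = stmt-HodgeConjecture-24833) until rung 0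
closes; count-neutral structure theory ((D-UNR) stays PRINT by D74′; LAYER C pays the type-(1) row in house only when it closes).

## References
* [Flicker1998UnitaryFL] Y. Z. Flicker, *Elementary proof of the fundamental lemma for a unitary group*, Canad. J. Math. 50 (1998), 74–98: §4 p. 85, Prop. 10 p. 86, Cor. 9 p. 85.
* [Rogawski1990] J. D. Rogawski, *Automorphic Representations of Unitary Groups in Three Variables* (1990), §4.9 p. 55.
-/

set_option autoImplicit false

open scoped MatrixGroups WithZero Valued
open Matrix

namespace Literature.NumberTheory.Automorphic

namespace UnitaryGroup

open Literature.NumberTheory.Automorphic.HermitianLattice (unitaryInt mem_unitaryInt_iff UnramifiedLocalConjDatum)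

variable {K : Type*} [Field K] [Valued K ℤᵐ⁰] {ϖ : K} (σ : K →+* K) {J : Matrix (Fin 3) (Fin 3) K}

/-! ## §1 The conjugate `(r_i)⁻¹ τ r_i` of a general corner block -/

omit [Valued K ℤᵐ⁰] in
/-- **`(r_i)⁻¹ · τ · r_i`** for `r_i = diag(ϖ^{−i}, 1, ϖ^i)` and a GENERAL corner block `τ = !![A, 0, B₁; 0, b, 0; B₂, 0, D]`: the corner entries scale by `ϖ^{±2i}`,
`!![A, 0, B₁·(ϖ^i ϖ^i); 0, b, 0; B₂·(ϖ^{−i} ϖ^{−i}), 0, D]` (corner-general twin of ★ `coe_radial_inv_mul_flickerTorus_mul_radial`, which is the symmetric-literal case).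
[cite: Flicker1998UnitaryFL, Cor. 9 p. 85; Prop. 6 p. 83] -/
theorem coe_radial_inv_mul_block_mul_radial (hϖ : ϖ ≠ 0) {τ r : ↥(unitaryGroupOfForm σ J)} {A B₁ B₂ D b : K} (i : ℕ)
    (hτ : ((τ : GL (Fin 3) K) : Matrix (Fin 3) (Fin 3) K) = !![A, 0, B₁; 0, b, 0; B₂, 0, D])
    (hr : ((r : GL (Fin 3) K) : Matrix (Fin 3) (Fin 3) K) = !![ϖ⁻¹ ^ i, 0, 0; 0, 1, 0; 0, 0, ϖ ^ i]) :
    (((r⁻¹ * τ * r : ↥(unitaryGroupOfForm σ J)) : GL (Fin 3) K) : Matrix (Fin 3) (Fin 3) K) =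
      !![A, 0, B₁ * (ϖ ^ i * ϖ ^ i); 0, b, 0; B₂ * (ϖ⁻¹ ^ i * ϖ⁻¹ ^ i), 0, D] := by
  have hpi : ϖ ^ i ≠ 0 := pow_ne_zero _ hϖ
  have key : ((τ : GL (Fin 3) K) : Matrix (Fin 3) (Fin 3) K) * ((r : GL (Fin 3) K) : Matrix (Fin 3) (Fin 3) K) =
      ((r : GL (Fin 3) K) : Matrix (Fin 3) (Fin 3) K) * !![A, 0, B₁ * (ϖ ^ i * ϖ ^ i); 0, b, 0; B₂ * (ϖ⁻¹ ^ i * ϖ⁻¹ ^ i), 0, D] := by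
    rw [hτ, hr]
    simp only [Matrix.mul_fin_three]
    ext k l
    fin_cases k <;> fin_cases l <;> simp only [Matrix.of_apply, Matrix.cons_val', Matrix.cons_val_zero, Matrix.cons_val_one,
      Matrix.cons_val_fin_one, Matrix.cons_val, Matrix.empty_val', Fin.mk_one, Fin.zero_eta, Fin.reduceFinMk, mul_zero, zero_mul,
      add_zero, zero_add, mul_one, one_mul, inv_pow]
    all_goals field_simp
  rw [Subgroup.coe_mul, Subgroup.coe_mul, Units.val_mul, Units.val_mul, Matrix.mul_assoc, key, ← Matrix.mul_assoc, Subgroup.coe_inv,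
    Units.inv_mul, Matrix.one_mul]

/-! ## §2 No solution when `|B₂| > 1` -/

/-- **No solution when `|B₂| > 1`, 2-free** (`j > N`; twin of ★ `natCard_cosets_eq_zero_of_one_lt` for the 2-free level element `u = u_m^{(y,z)}` and a GENERAL corner):
the coset count of `τ = !![A, 0, B₁; 0, b, 0; B₂, 0, D]` vanishes, since for `p = p(u₁, x, w) ∈ P_H` (★ p851950) the first condition `|u₁σu₁·B₂| ≤ 1` of ★ p851957
`borel_conj_mem_unitaryInt_iff_of_rel` fails (`|u₁| = |σu₁| = 1`).  `h2 : (2 : K) ≠ 0` is the characteristic token of `P_H`'s block shape, not `|2| = 1`.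
[cite: Flicker1998UnitaryFL, Prop. 10 p. 86; §4 p. 85] -/
theorem natCard_cosets_eq_zero_of_one_lt_of_rel (hJ : J = (StdForm.antidiagonal 3).over K) (hd : UnramifiedLocalConjDatum σ ϖ) (h2 : (2 : K) ≠ 0)
    {y z : K} (hy : Valued.v y = 1) (hz : z + σ z + y * σ y = 0) (m : ℕ)
    {c u τ : ↥(unitaryGroupOfForm σ J)} (hc : ((c : GL (Fin 3) K) : Matrix (Fin 3) (Fin 3) K) = !![1, 0, 0; 0, -1, 0; 0, 0, 1])
    (hu : ((u : GL (Fin 3) K) : Matrix (Fin 3) (Fin 3) K) = !![ϖ ^ m, y, z * (ϖ ^ m)⁻¹; 0, 1, -σ y * (ϖ ^ m)⁻¹; 0, 0, (ϖ ^ m)⁻¹])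
    {A B₁ B₂ D b : K} (hτ : ((τ : GL (Fin 3) K) : Matrix (Fin 3) (Fin 3) K) = !![A, 0, B₁; 0, b, 0; B₂, 0, D])
    (hgt : 1 < Valued.v B₂) :
    Nat.card {w : ↥(flickerPH σ J c) ⧸ (flickerHK σ J c u).subgroupOf (flickerPH σ J c) //
      ((Quotient.out w : ↥(flickerPH σ J c)) : ↥(unitaryGroupOfForm σ J))⁻¹ * τ * (Quotient.out w : ↥(flickerPH σ J c)) ∈ flickerHK σ J c u} = 0 := by
  refine natCard_cosets_eq_zero_of_forall_not σ fun p hp hmem => ?_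
  obtain ⟨u₁, x, w, hpm, hvu, -, -, hvw, -⟩ := exists_coe_eq_borel_of_mem_flickerPH' σ hJ hd.σσ hd.vσ h2 hc hp
  have hu0 : u₁ ≠ 0 := fun h => by rw [h, map_zero] at hvu; exact zero_ne_one hvu
  have hσu0 : σ u₁ ≠ 0 := fun h => hu0 (by rw [← hd.σσ u₁, h, map_zero])
  have hw0 : w ≠ 0 := fun h => by rw [h, map_zero] at hvw; exact zero_ne_one hvw
  have hK : u⁻¹ * (p⁻¹ * τ * p) * u ∈ unitaryInt σ J := (mem_flickerHK_iff.1 hmem).2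
  obtain ⟨h₁, -, -, -⟩ := (borel_conj_mem_unitaryInt_iff_of_rel σ hJ hd hy hz m hu0 hσu0 hw0 hu hpm hτ).1 hK
  rw [map_mul, map_mul, hd.vσ, hvu, one_mul, one_mul] at h₁
  exact absurd hgt (not_lt.2 h₁)

/-! ## §3 The same at the trace torus literal -/

/-- **The same at the trace torus literal, 2-free** (twin of ★ `natCard_cosets_flickerTorus_eq_zero_of_lt`): for the ★ F1 literal
`t = M(x₁,x₂,x₃) = !![x₁σb₀ + x₃b₀, 0, π(x₁ − x₃); 0, x₂, 0; π′·b₀σb₀·(x₁ − x₃), 0, x₁b₀ + x₃σb₀]` (`b₀ + σb₀ = 1`, `|b₀| ≤ 1`, `π′ = ϖ^{−θ̄}`), `r_i = diag(ϖ^{−i}, 1, ϖ^i)` and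
`N < 2i + θ̄` (`|x₁ − x₃| = |ϖ^N|`), the coset count of `(r_i)⁻¹ t r_i` is `0` — the summands of the trace-frame Cor. 9 sum beyond `j = N` vanish (lower corner
`B₂ = π′b₀σb₀(x₁−x₃)ϖ^{−2i}`, `|B₂| = |ϖ|^{N − 2i − θ̄} > 1`; `|b₀σb₀| = 1` by ★ `v_norm_eq_one_of_trace_unit`). [cite: Flicker1998UnitaryFL, §4 p. 85; Prop. 10 p. 86] -/
theorem natCard_cosets_traceTorus_eq_zero_of_lt (hJ : J = (StdForm.antidiagonal 3).over K) (hd : UnramifiedLocalConjDatum σ ϖ) (h2 : (2 : K) ≠ 0)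
    {y z : K} (hy : Valued.v y = 1) (hz : z + σ z + y * σ y = 0)
    {c u t r : ↥(unitaryGroupOfForm σ J)} (hc : ((c : GL (Fin 3) K) : Matrix (Fin 3) (Fin 3) K) = !![1, 0, 0; 0, -1, 0; 0, 0, 1])
    {m : ℕ} (hu : ((u : GL (Fin 3) K) : Matrix (Fin 3) (Fin 3) K) = !![ϖ ^ m, y, z * (ϖ ^ m)⁻¹; 0, 1, -σ y * (ϖ ^ m)⁻¹; 0, 0, (ϖ ^ m)⁻¹])
    {b₀ π π' x₁ x₂ x₃ : K} (hb₀ : b₀ + σ b₀ = 1) (hb₀v : Valued.v b₀ ≤ 1) {θbar : ℕ} (hπ' : π' = (ϖ ^ θbar)⁻¹)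
    (ht : ((t : GL (Fin 3) K) : Matrix (Fin 3) (Fin 3) K) =
      !![x₁ * σ b₀ + x₃ * b₀, 0, π * (x₁ - x₃); 0, x₂, 0; π' * (b₀ * σ b₀ * (x₁ - x₃)), 0, x₁ * b₀ + x₃ * σ b₀])
    {i : ℕ} (hr : ((r : GL (Fin 3) K) : Matrix (Fin 3) (Fin 3) K) = !![ϖ⁻¹ ^ i, 0, 0; 0, 1, 0; 0, 0, ϖ ^ i])
    {N : ℕ} (hN : Valued.v (x₁ - x₃) = Valued.v (ϖ ^ N)) (hlt : N < 2 * i + θbar) :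
    Nat.card {w : ↥(flickerPH σ J c) ⧸ (flickerHK σ J c u).subgroupOf (flickerPH σ J c) //
      ((Quotient.out w : ↥(flickerPH σ J c)) : ↥(unitaryGroupOfForm σ J))⁻¹ * (r⁻¹ * t * r) * (Quotient.out w : ↥(flickerPH σ J c)) ∈
        flickerHK σ J c u} = 0 := by
  have hϖ0 : ϖ ≠ 0 := hd.ϖ_ne_zero
  -- `|b₀σb₀| = 1` from the trace alone (every residue characteristic)
  have hN1 : Valued.v (b₀ * σ b₀) = 1 :=
    v_norm_eq_one_of_trace_unit σ hd.vσ hb₀v (by rw [hb₀, map_one])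
  have hτ := coe_radial_inv_mul_block_mul_radial σ hϖ0 i ht hr
  refine natCard_cosets_eq_zero_of_one_lt_of_rel σ hJ hd h2 hy hz m hc hu hτ ?_
  -- `|B₂| = |ϖ|^{N − 2i − θ̄} > 1`
  have e1 : Valued.v (π' * (b₀ * σ b₀ * (x₁ - x₃)) * (ϖ⁻¹ ^ i * ϖ⁻¹ ^ i)) =
      Valued.v π' * Valued.v (x₁ - x₃) * (Valued.v ((ϖ ^ i)⁻¹) * Valued.v ((ϖ ^ i)⁻¹)) := by
    rw [inv_pow]; simp only [map_mul, hN1, one_mul]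
  rw [e1, hN, hπ', hd.v_pow_inv, hd.v_pow_inv, hd.v_pow, ← WithZero.exp_add, ← WithZero.exp_add, ← WithZero.exp_add,
    ← WithZero.exp_zero, WithZero.exp_lt_exp]
  omega

end UnitaryGroup

end Literature.NumberTheory.Automorphic
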